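import Summits.AnomalousDissipation.AnomalousDissipation.Theorems.SawtoothPulseCascadeK1LocalisedCascadeFibreMinkowski
import Summits.AnomalousDissipation.AnomalousDissipation.Theorems.SawtoothPulseCascadeK1LocalisedCascadePhaseOneJunkSplit

/-!
# K1loc, line `Spectral` / thin start — helper: SHARP CHIRP TABLES AND WINDOW MASSES BELOW THE LOBE («ChirpWindowMass», D1)

Helper file of the prover lane on the crux `K1LocalisedCascade` (stmt-AnomalousDissipation-19491), route `SawtoothPulseCascade`
(glue seat; arbiter A24-2 (2); plan `PHASE1-DIRECT-SIZING-k1locp3g4.md` §4, item D1).  The per-fibre Minkowski bound of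
`…FibreMinkowski` consumes two explicit inputs: SHARP termwise magnitudes of the exact chirps and the WINDOW MASS
`Σ_{m∈W} ‖ĝ₀(m)‖²` of the `N`-tooth chirp in a window below its lobe.  From the closed form `…CornerTraceTerm.fourierCoeff_nTooth_exactChirp`:
* `norm_fourierCoeff_nTooth_le`: `‖ĝ₀(m)‖ ≤ [N ∣ m]·|sin(π(λ+m)/(2N))|·2N|λ|/(π|λ²−m²|)` (`λ ± m ≠ 0`);
* `norm_fourierCoeff_oneTooth_le_sharp`: the one-tooth chirp, `‖ĝ₀(m)‖ ≤ 2|λ|/(π|λ²−m²|)` — the SIGNED form `|1/(λ+m) + 1/(λ−m)|`, which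
  decays like `m⁻²` (the triangle form `1/|λ+m| + 1/|λ−m|` of `…ExactChirp` only like `m⁻¹`);
* `norm_fourierCoeff_twoTooth_le`: the two-tooth chirp of lobe `8n`: `‖ĝ₀(m)‖ ≤ [m ≡ 2 (4)]·32|n|/(π|64n²−m²|)` — half the even `m` drop
  out (`sin(π(8n+m)/4) = 0` for `4 ∣ m`);
* `sum_Ico_inv_sq_prog_le`: the telescoping bound `Σ_{K₁≤k<K} 1/(λ−(4k+2))² ≤ ¼(1/(λ−4K) − 1/(λ−4K₁))`;
* **`sum_window_sq_norm_twoTooth_le`**: for a window `W ⊆ [−(4K−2), 4K−2]` below the lobe (`4K < 8|n|`) and a split index `K₁ ≤ K`,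
  `Σ_{m∈W} ‖ĝ₀(m)‖² ≤ 2(32n/π)²·¼·[(1/λ²)(1/(λ−4K₁) − 1/λ) + (1/(λ+4K₁+2)²)(1/(λ−4K) − 1/(λ−4K₁))]`, `λ = 8|n|` (two-piece:
  `(λ+m)² ≥ λ²` on the inner piece, `≥ (λ+4K₁+2)²` on the outer);
* `sqrt_window_shift_twist_le`: the rounded cascade chirp in a shifted window, `√Σ_{m∈W}‖ĝ(m−q)‖² ≤ √Σ_{m∈W}‖ĝ₀(m−q)‖² + 2πη`.
No definitions; nothing about the crux. [cite: Grafakos2014, Prop. 3.1.2 (5), Prop. 3.2.7 (3)] [problem: turb]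
-/

-- `Summit.<Summit>.<Problem>`: single-conjunct summit, the duplicate namespace segment is deliberate.
set_option linter.dupNamespace false

noncomputable section

namespace Summit.AnomalousDissipation.AnomalousDissipation.Theorems.SawtoothPulseCascade.K1Window

open MeasureTheory Filter Topology UnitAddTorus Complex AddCircle
open scoped Real
open Literature.Analysis Literature.Analysis.FunctionSpaces Literature.Analysis.FunctionSpaces.Torus Literature.Analysis.FluidPDE
open Literature.Analysis.FluidPDE.ShearStage
open Literature.Analysis.FluidPDE.SawtoothCascade Literature.Analysis.FluidPDE.SawtoothCascade.CascadeParams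
open Summit.AnomalousDissipation.AnomalousDissipation.Theorems.SawtoothPulseCascade.K1Start

/-! ## §1 Sharp termwise magnitudes of the exact chirps -/

/-- `N/(π(λ+m)) + N/(π(λ−m)) = 2Nλ/(π(λ²−m²))`. [folklore] -/
theorem nTooth_amp_eq {N lam m : ℝ} (h₁ : lam + m ≠ 0) (h₂ : lam - m ≠ 0) :
    N / (π * (lam + m)) + N / (π * (lam - m)) = 2 * N * lam / (π * (lam ^ 2 - m ^ 2)) := by
  have hπ : (π : ℝ) ≠ 0 := Real.pi_pos.ne'
  have h3 : lam ^ 2 - m ^ 2 = (lam + m) * (lam - m) := by ring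
  rw [h3]
  field_simp
  ring

/-- **The `N`-tooth exact chirp, sharp termwise magnitude**: for `g₀(t) = exp(−2πiλ·tri(2πNt)/(2πN))` and `λ ± m ≠ 0`,
`‖ĝ₀(m)‖ ≤ [N ∣ m]·|sin(π(λ+m)/(2N))|·2N|λ|/(π|λ²−m²|)`. [cite: Grafakos2014, Prop. 3.1.2 (5)] -/
theorem norm_fourierCoeff_nTooth_le {N : ℕ} (hN : 0 < N) (lam : ℤ) {g₀ : UnitAddCircle → ℂ}
    (hg₀ : ∀ t : ℝ, g₀ (t : UnitAddCircle) = Complex.exp (-(2 * π * I * lam * ((tri (2 * π * N * t) / (2 * π * N) : ℝ) : ℂ))))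
    {m : ℤ} (hm₁ : lam + m ≠ 0) (hm₂ : lam - m ≠ 0) :
    ‖fourierCoeff g₀ m‖ ≤ if (N : ℤ) ∣ m then
      |Real.sin (π * (lam + m) / (2 * N))| * (2 * N * |(lam : ℝ)| / (π * |(lam : ℝ) ^ 2 - (m : ℝ) ^ 2|)) else 0 := by
  rw [fourierCoeff_nTooth_exactChirp hN lam hg₀ hm₁ hm₂]
  split_ifs with hdvd
  · have h₁ : (lam : ℝ) + m ≠ 0 := by exact_mod_cast hm₁
    have h₂ : (lam : ℝ) - m ≠ 0 := by exact_mod_cast hm₂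
    rw [Complex.norm_real, Real.norm_eq_abs, abs_mul, nTooth_amp_eq h₁ h₂, abs_div, abs_mul, abs_mul, abs_mul,
      abs_of_pos Real.pi_pos, abs_of_nonneg (by positivity : (0 : ℝ) ≤ 2), Nat.abs_cast]
  · simp

/-- **The one-tooth exact chirp, SHARP form**: for `g₀(t) = exp(−2πiλ·tri(2πt)/(2π))` and `λ ± m ≠ 0`,
`‖ĝ₀(m)‖ ≤ 2|λ|/(π|λ²−m²|)` (`= 16/(π|q²−64|)` for `λ = 8`, `16|q|/(π|64q²−m²|)` for `λ = 8q`). [cite: Grafakos2014, Prop. 3.1.2 (5)] -/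
theorem norm_fourierCoeff_oneTooth_le_sharp (lam : ℤ) {g₀ : UnitAddCircle → ℂ}
    (hg₀ : ∀ t : ℝ, g₀ (t : UnitAddCircle) = Complex.exp (-(2 * π * I * lam * ((tri (2 * π * t) / (2 * π) : ℝ) : ℂ))))
    {m : ℤ} (hm₁ : lam + m ≠ 0) (hm₂ : lam - m ≠ 0) :
    ‖fourierCoeff g₀ m‖ ≤ 2 * |(lam : ℝ)| / (π * |(lam : ℝ) ^ 2 - (m : ℝ) ^ 2|) := by
  have hg₀' : ∀ t : ℝ, g₀ (t : UnitAddCircle) =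
      Complex.exp (-(2 * π * I * lam * ((tri (2 * π * (1 : ℕ) * t) / (2 * π * (1 : ℕ)) : ℝ) : ℂ))) := fun t => by
    rw [hg₀ t]; simp
  have h := norm_fourierCoeff_nTooth_le one_pos lam hg₀' hm₁ hm₂
  have h1 : ((1 : ℕ) : ℤ) ∣ m := by simp
  rw [if_pos h1] at h
  refine h.trans ?_
  have hs : |Real.sin (π * (lam + m) / (2 * (1 : ℕ)))| ≤ 1 := Real.abs_sin_le_one _
  have h0 : 0 ≤ 2 * (1 : ℕ) * |(lam : ℝ)| / (π * |(lam : ℝ) ^ 2 - (m : ℝ) ^ 2|) := by positivity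
  calc |Real.sin (π * (lam + m) / (2 * (1 : ℕ)))| * (2 * (1 : ℕ) * |(lam : ℝ)| / (π * |(lam : ℝ) ^ 2 - (m : ℝ) ^ 2|))
      ≤ 1 * (2 * (1 : ℕ) * |(lam : ℝ)| / (π * |(lam : ℝ) ^ 2 - (m : ℝ) ^ 2|)) := mul_le_mul_of_nonneg_right hs h0
    _ = _ := by simp

/-- **The two-tooth exact chirp of lobe `8n`** (the phase-1 H/V chirp of fibre `n` at `γ = 8`): for `g₀(t) = exp(−2πi·8n·tri(4πt)/(4π))`
and `m ≠ ±8n`, `‖ĝ₀(m)‖ ≤ [m ≡ 2 (mod 4)]·32|n|/(π|64n²−m²|)` (`2 ∤ m ⇒ 0`; `4 ∣ m ⇒ sin(π(8n+m)/4) = sin(π(2n + m/4)) = 0`).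
[cite: Grafakos2014, Prop. 3.1.2 (5)] -/
theorem norm_fourierCoeff_twoTooth_le (n : ℤ) {g₀ : UnitAddCircle → ℂ}
    (hg₀ : ∀ t : ℝ, g₀ (t : UnitAddCircle) =
      Complex.exp (-(2 * π * I * ((8 * n : ℤ)) * ((tri (2 * π * (2 : ℕ) * t) / (2 * π * (2 : ℕ)) : ℝ) : ℂ))))
    {m : ℤ} (hm₁ : 8 * n + m ≠ 0) (hm₂ : 8 * n - m ≠ 0) :
    ‖fourierCoeff g₀ m‖ ≤ if m % 4 = 2 then 32 * |(n : ℝ)| / (π * |64 * (n : ℝ) ^ 2 - (m : ℝ) ^ 2|) else 0 := by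
  have h := norm_fourierCoeff_nTooth_le (N := 2) two_pos (8 * n) hg₀ hm₁ hm₂
  have e64 : (((8 * n : ℤ)) : ℝ) ^ 2 = 64 * (n : ℝ) ^ 2 := by push_cast; ring
  have e8 : |(((8 * n : ℤ)) : ℝ)| = 8 * |(n : ℝ)| := by
    push_cast; rw [abs_mul, abs_of_pos (by norm_num : (0 : ℝ) < 8)]
  rw [e64, e8] at h
  by_cases h2 : ((2 : ℕ) : ℤ) ∣ m
  · rw [if_pos h2] at h
    by_cases h4 : m % 4 = 2
    · rw [if_pos h4]
      refine h.trans ?_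
      have hs : |Real.sin (π * ((8 * n : ℤ) + m) / (2 * (2 : ℕ)))| ≤ 1 := Real.abs_sin_le_one _
      have h0 : 0 ≤ 2 * (2 : ℕ) * (8 * |(n : ℝ)|) / (π * |64 * (n : ℝ) ^ 2 - (m : ℝ) ^ 2|) := by positivity
      calc |Real.sin (π * ((8 * n : ℤ) + m) / (2 * (2 : ℕ)))| * (2 * (2 : ℕ) * (8 * |(n : ℝ)|) / (π * |64 * (n : ℝ) ^ 2 - (m : ℝ) ^ 2|))
          ≤ 1 * (2 * (2 : ℕ) * (8 * |(n : ℝ)|) / (π * |64 * (n : ℝ) ^ 2 - (m : ℝ) ^ 2|)) := mul_le_mul_of_nonneg_right hs h0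
        _ = _ := by push_cast; ring
    · rw [if_neg h4]
      -- `2 ∣ m`, `m % 4 ≠ 2` ⇒ `4 ∣ m` ⇒ the sine vanishes
      have h4' : (4 : ℤ) ∣ m := by
        have : (2 : ℤ) ∣ m := by exact_mod_cast h2
        omega
      obtain ⟨k, hk⟩ := h4'
      have hsin : Real.sin (π * ((8 * n : ℤ) + m) / (2 * (2 : ℕ))) = 0 := by
        rw [hk]
        have e : π * (((8 * n : ℤ) : ℝ) + ((4 * k : ℤ) : ℝ)) / (2 * (2 : ℕ)) = ((2 * n + k : ℤ) : ℝ) * π := by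
          push_cast; ring
        rw [e, Real.sin_int_mul_pi]
      rw [hsin, abs_zero, zero_mul] at h
      exact h
  · rw [if_neg h2] at h
    have h4 : ¬ m % 4 = 2 := by
      intro h4
      apply h2
      have : (2 : ℤ) ∣ m := by omega
      exact_mod_cast this
    rw [if_neg h4]
    exact h

/-! ## §2 The window mass of the two-tooth chirp below its lobe -/

/-- **Telescoping over the progression `4k+2`**: for `4K < λ` and `K₁ ≤ K`,
`Σ_{K₁ ≤ k < K} 1/(λ−(4k+2))² ≤ ¼(1/(λ−4K) − 1/(λ−4K₁))` (`1/x² ≤ 1/(x²−4) = ¼(1/(x−2) − 1/(x+2))`). [folklore] -/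
theorem sum_Ico_inv_sq_prog_le (lam : ℝ) {K₁ K : ℕ} (hK : K₁ ≤ K) (hlam : 4 * (K : ℝ) < lam) :
    ∑ k ∈ Finset.Ico K₁ K, 1 / (lam - (4 * (k : ℝ) + 2)) ^ 2 ≤ 1 / 4 * (1 / (lam - 4 * K) - 1 / (lam - 4 * K₁)) := by
  induction K, hK using Nat.le_induction with
  | base => simp
  | succ K hK ih =>
    have hK' : 4 * (K : ℝ) < lam := by push_cast at hlam; linarith
    rw [Finset.sum_Ico_succ_top hK]
    have step : 1 / (lam - (4 * (K : ℝ) + 2)) ^ 2 ≤ 1 / 4 * (1 / (lam - 4 * ((K + 1 : ℕ) : ℝ)) - 1 / (lam - 4 * K)) := by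
      set x : ℝ := lam - (4 * K + 2) with hx
      have hx2 : 2 < x := by rw [hx]; push_cast at hlam; linarith
      have e1 : lam - 4 * ((K + 1 : ℕ) : ℝ) = x - 2 := by rw [hx]; push_cast; ring
      have e2 : lam - 4 * (K : ℝ) = x + 2 := by rw [hx]; ring
      rw [e1, e2]
      have hx0 : 0 < x - 2 := by linarith
      have hxm : x - 2 ≠ 0 := hx0.ne'
      have hxp : x + 2 ≠ 0 := by linarith
      have hxx : x ^ 2 - 4 ≠ 0 := by nlinarith
      have hx4 : 1 / 4 * (1 / (x - 2) - 1 / (x + 2)) = 1 / (x ^ 2 - 4) := by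
        rw [div_sub_div _ _ hxm hxp, show x ^ 2 - 4 = (x - 2) * (x + 2) by ring]
        field_simp
        ring
      rw [hx4]
      exact one_div_le_one_div_of_le (by nlinarith) (by nlinarith)
    have := ih hK'
    linarith

/-- **WINDOW MASS OF THE TWO-TOOTH CHIRP BELOW THE LOBE** (two-piece telescoping): `n ≠ 0`, `λ = 8|n|`, `g₀` the exact two-tooth
chirp of lobe `8n`, a finite window `W` with `|m| ≤ 4K − 2` on `W`, `4K < λ` and a split index `K₁ ≤ K`:
`Σ_{m∈W} ‖ĝ₀(m)‖² ≤ 2·(32|n|/π)²·¼·[(1/λ²)(1/(λ−4K₁) − 1/λ) + (1/(λ+4K₁+2)²)(1/(λ−4K) − 1/(λ−4K₁))]`.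
[cite: Grafakos2014, Prop. 3.1.2 (5), Prop. 3.2.7 (3)] -/
theorem sum_window_sq_norm_twoTooth_le {n : ℤ} (hn : n ≠ 0) {g₀ : UnitAddCircle → ℂ}
    (hg₀ : ∀ t : ℝ, g₀ (t : UnitAddCircle) =
      Complex.exp (-(2 * π * I * ((8 * n : ℤ)) * ((tri (2 * π * (2 : ℕ) * t) / (2 * π * (2 : ℕ)) : ℝ) : ℂ))))
    {lam : ℝ} (hlam : lam = 8 * |(n : ℝ)|)
    {K₁ K : ℕ} (hK₁ : K₁ ≤ K) (hK : 4 * (K : ℝ) < lam) (W : Finset ℤ) (hW : ∀ m, m ∈ W → |m| ≤ 4 * (K : ℤ) - 2) :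
    ∑ m ∈ W, ‖fourierCoeff g₀ m‖ ^ 2 ≤
      2 * (32 * |(n : ℝ)| / π) ^ 2 * (1 / 4 * ((1 / lam) ^ 2 * (1 / (lam - 4 * K₁) - 1 / lam) +
        (1 / (lam + 4 * K₁ + 2)) ^ 2 * (1 / (lam - 4 * K) - 1 / (lam - 4 * K₁)))) := by
  classical
  have hπ : 0 < π := Real.pi_pos
  have hn' : 0 < |(n : ℝ)| := abs_pos.2 (Int.cast_ne_zero.2 hn)
  have hlam0 : 0 < lam := by rw [hlam]; positivity
  -- the termwise bound `G(m)²`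
  set G : ℤ → ℝ := fun m => if m % 4 = 2 then 32 * |(n : ℝ)| / (π * |64 * (n : ℝ) ^ 2 - (m : ℝ) ^ 2|) else 0 with hG
  have hG0 : ∀ m, 0 ≤ G m := fun m => by simp only [hG]; split_ifs <;> positivity
  have hmW : ∀ m ∈ W, |(m : ℝ)| ≤ 4 * K - 2 := fun m hm => by exact_mod_cast hW m hm
  have hterm : ∀ m ∈ W, ‖fourierCoeff g₀ m‖ ^ 2 ≤ G m ^ 2 := by
    intro m hm
    have hma := hmW m hm
    have hml : |(m : ℝ)| < lam := by linarith
    have h8 : |((8 * n : ℤ) : ℝ)| = lam := by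
      rw [hlam]; push_cast; rw [abs_mul, abs_of_pos (by norm_num : (0:ℝ) < 8)]
    have hm₁ : 8 * n + m ≠ 0 := by
      intro h
      have e : m = -(8 * n) := by linarith
      have : |(m : ℝ)| = lam := by
        rw [← h8, show (m : ℝ) = -(((8 * n : ℤ)) : ℝ) by exact_mod_cast e, abs_neg]
      linarith
    have hm₂ : 8 * n - m ≠ 0 := by
      intro h
      have e : m = 8 * n := by linarith
      have : |(m : ℝ)| = lam := by
        rw [← h8, show (m : ℝ) = (((8 * n : ℤ)) : ℝ) by exact_mod_cast e]
      linarith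
    exact pow_le_pow_left₀ (norm_nonneg _) (norm_fourierCoeff_twoTooth_le n hg₀ hm₁ hm₂) 2
  refine (Finset.sum_le_sum hterm).trans ?_
  -- restrict to the residue class and split into the positive / negative progressions
  set Pp : Finset ℤ := (Finset.range K).image fun k : ℕ => (4 * (k : ℤ) + 2) with hPp
  set Pm : Finset ℤ := (Finset.range K).image fun k : ℕ => -(4 * (k : ℤ) + 2) with hPm
  have hsub : W.filter (fun m => m % 4 = 2) ⊆ Pp ∪ Pm := by
    intro m hm
    rw [Finset.mem_filter] at hm
    obtain ⟨hmW', hres⟩ := hm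
    have hb := hW m hmW'
    rw [Finset.mem_union]
    rcases le_or_gt 0 m with h0 | h0
    · left
      rw [hPp, Finset.mem_image]
      refine ⟨((m - 2) / 4).toNat, ?_, ?_⟩
      · rw [Finset.mem_range]
        have : (m - 2) / 4 < K := by rw [abs_of_nonneg h0] at hb; omega
        omega
      · omega
    · right
      rw [hPm, Finset.mem_image]
      refine ⟨((-m - 2) / 4).toNat, ?_, ?_⟩
      · rw [Finset.mem_range]
        have : (-m - 2) / 4 < K := by rw [abs_of_neg h0] at hb; omega
        omega
      · omega
  have hzero : ∀ m ∈ W, m ∉ W.filter (fun m => m % 4 = 2) → G m ^ 2 = 0 := by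
    intro m hm hnot
    rw [Finset.mem_filter, not_and] at hnot
    simp [hG, hnot hm]
  have h1 : ∑ m ∈ W, G m ^ 2 = ∑ m ∈ W.filter (fun m => m % 4 = 2), G m ^ 2 :=
    (Finset.sum_subset (Finset.filter_subset _ W) (fun m hm hnot => hzero m hm hnot)).symm
  have h2 : ∑ m ∈ W.filter (fun m => m % 4 = 2), G m ^ 2 ≤ ∑ m ∈ Pp ∪ Pm, G m ^ 2 :=
    Finset.sum_le_sum_of_subset_of_nonneg hsub fun m _ _ => sq_nonneg _
  have h3 : ∑ m ∈ Pp ∪ Pm, G m ^ 2 ≤ ∑ m ∈ Pp, G m ^ 2 + ∑ m ∈ Pm, G m ^ 2 := by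
    have h := Finset.sum_union_inter (s₁ := Pp) (s₂ := Pm) (f := fun m => G m ^ 2)
    have h0 : 0 ≤ ∑ m ∈ Pp ∩ Pm, G m ^ 2 := Finset.sum_nonneg fun m _ => sq_nonneg _
    linarith
  -- both progressions give the same sum of `1/(λ²−m²)²`-type terms
  have hinjp : Set.InjOn (fun k : ℕ => (4 * (k : ℤ) + 2)) (Finset.range K : Set ℕ) := fun a _ b _ h => by
    simpa using h
  have hinjm : Set.InjOn (fun k : ℕ => -(4 * (k : ℤ) + 2)) (Finset.range K : Set ℕ) := fun a _ b _ h => by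
    simpa using h
  have hGsq : ∀ (k : ℕ), k < K → ∀ (s : ℤ), (s = 4 * (k : ℤ) + 2 ∨ s = -(4 * (k : ℤ) + 2)) →
      G s ^ 2 ≤ (32 * |(n : ℝ)| / π) ^ 2 * (1 / ((lam - (4 * (k : ℝ) + 2)) ^ 2 * (lam + (4 * (k : ℝ) + 2)) ^ 2)) := by
    intro k hk s hs
    have hsR : (s : ℝ) ^ 2 = (4 * (k : ℝ) + 2) ^ 2 := by
      rcases hs with rfl | rfl <;> push_cast <;> ring
    have hkK : 4 * (k : ℝ) + 2 < lam := by
      have : (k : ℝ) + 1 ≤ K := by exact_mod_cast hk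
      linarith
    have hd : 64 * (n : ℝ) ^ 2 - (s : ℝ) ^ 2 = (lam - (4 * k + 2)) * (lam + (4 * k + 2)) := by
      rw [hsR, hlam]
      have : |(n:ℝ)| ^ 2 = (n : ℝ) ^ 2 := sq_abs _
      nlinarith [this]
    have hdpos : 0 < 64 * (n : ℝ) ^ 2 - (s : ℝ) ^ 2 := by rw [hd]; exact mul_pos (by linarith) (by linarith)
    simp only [hG]
    split_ifs with hres
    · rw [abs_of_pos hdpos, hd, div_pow, mul_pow, div_pow]
      apply le_of_eq
      field_simp
    · rw [zero_pow two_ne_zero]; positivity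
  have hsumP : ∀ (Pq : Finset ℤ) (f : ℕ → ℤ), Pq = (Finset.range K).image f → Set.InjOn f (Finset.range K : Set ℕ) →
      (∀ k, f k = 4 * (k : ℤ) + 2 ∨ f k = -(4 * (k : ℤ) + 2)) →
      ∑ m ∈ Pq, G m ^ 2 ≤ (32 * |(n : ℝ)| / π) ^ 2 *
        ∑ k ∈ Finset.range K, 1 / ((lam - (4 * (k : ℝ) + 2)) ^ 2 * (lam + (4 * (k : ℝ) + 2)) ^ 2) := by
    intro Pq f hPq hinj hf
    rw [hPq, Finset.sum_image hinj, Finset.mul_sum]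
    exact Finset.sum_le_sum fun k hk => hGsq k (Finset.mem_range.1 hk) (f k) (hf k)
  have hP1 := hsumP Pp _ hPp hinjp (fun k => Or.inl rfl)
  have hP2 := hsumP Pm _ hPm hinjm (fun k => Or.inr rfl)
  -- the two-piece telescoping bound for `Σ_{k<K} 1/((λ−m_k)²(λ+m_k)²)`
  have hsplit : ∑ k ∈ Finset.range K, 1 / ((lam - (4 * (k : ℝ) + 2)) ^ 2 * (lam + (4 * (k : ℝ) + 2)) ^ 2) ≤
      1 / 4 * ((1 / lam) ^ 2 * (1 / (lam - 4 * K₁) - 1 / lam) +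
        (1 / (lam + 4 * K₁ + 2)) ^ 2 * (1 / (lam - 4 * K) - 1 / (lam - 4 * K₁))) := by
    rw [Finset.range_eq_Ico, ← Finset.sum_Ico_consecutive _ (Nat.zero_le K₁) hK₁]
    have hK₁r : 4 * (K₁ : ℝ) < lam := by
      have : (K₁ : ℝ) ≤ K := by exact_mod_cast hK₁
      linarith
    have hA : ∑ k ∈ Finset.Ico 0 K₁, 1 / ((lam - (4 * (k : ℝ) + 2)) ^ 2 * (lam + (4 * (k : ℝ) + 2)) ^ 2) ≤
        (1 / lam) ^ 2 * (1 / 4 * (1 / (lam - 4 * K₁) - 1 / (lam - 4 * (0 : ℕ)))) := by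
      refine le_trans ?_ (mul_le_mul_of_nonneg_left (sum_Ico_inv_sq_prog_le lam (Nat.zero_le K₁) hK₁r) (by positivity))
      rw [Finset.mul_sum]
      refine Finset.sum_le_sum fun k hk => ?_
      have hk2 : 4 * (k : ℝ) + 2 < lam := by
        have : (k : ℝ) + 1 ≤ K₁ := by exact_mod_cast (Finset.mem_Ico.1 hk).2
        linarith
      have hpos1 : 0 < lam - (4 * (k : ℝ) + 2) := by linarith
      have hpos2 : lam ≤ lam + (4 * (k : ℝ) + 2) := by linarith [(Nat.cast_nonneg k : (0:ℝ) ≤ k)]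
      calc 1 / ((lam - (4 * (k : ℝ) + 2)) ^ 2 * (lam + (4 * (k : ℝ) + 2)) ^ 2)
          ≤ 1 / ((lam - (4 * (k : ℝ) + 2)) ^ 2 * lam ^ 2) :=
            one_div_le_one_div_of_le (by positivity)
              (mul_le_mul_of_nonneg_left (pow_le_pow_left₀ hlam0.le hpos2 2) (sq_nonneg _))
        _ = (1 / lam) ^ 2 * (1 / (lam - (4 * (k : ℝ) + 2)) ^ 2) := by
            rw [div_pow, one_pow, ← one_div_mul_one_div, mul_comm]
    have hB : ∑ k ∈ Finset.Ico K₁ K, 1 / ((lam - (4 * (k : ℝ) + 2)) ^ 2 * (lam + (4 * (k : ℝ) + 2)) ^ 2) ≤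
        (1 / (lam + 4 * K₁ + 2)) ^ 2 * (1 / 4 * (1 / (lam - 4 * K) - 1 / (lam - 4 * K₁))) := by
      refine le_trans ?_ (mul_le_mul_of_nonneg_left (sum_Ico_inv_sq_prog_le lam hK₁ hK) (by positivity))
      rw [Finset.mul_sum]
      refine Finset.sum_le_sum fun k hk => ?_
      have hk1 : (K₁ : ℝ) ≤ k := by exact_mod_cast (Finset.mem_Ico.1 hk).1
      have hpos2 : lam + 4 * K₁ + 2 ≤ lam + (4 * (k : ℝ) + 2) := by linarith
      have hk2 : 4 * (k : ℝ) + 2 < lam := by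
        have : (k : ℝ) + 1 ≤ K := by exact_mod_cast (Finset.mem_Ico.1 hk).2
        linarith
      have hpos1 : 0 < lam - (4 * (k : ℝ) + 2) := by linarith
      calc 1 / ((lam - (4 * (k : ℝ) + 2)) ^ 2 * (lam + (4 * (k : ℝ) + 2)) ^ 2)
          ≤ 1 / ((lam - (4 * (k : ℝ) + 2)) ^ 2 * (lam + 4 * K₁ + 2) ^ 2) :=
            one_div_le_one_div_of_le (by positivity)
              (mul_le_mul_of_nonneg_left (pow_le_pow_left₀ (by positivity) hpos2 2) (sq_nonneg _))
        _ = (1 / (lam + 4 * K₁ + 2)) ^ 2 * (1 / (lam - (4 * (k : ℝ) + 2)) ^ 2) := by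
            rw [div_pow, one_pow, ← one_div_mul_one_div, mul_comm]
    simp only [Nat.cast_zero, mul_zero, sub_zero] at hA
    linarith
  have h0c : 0 ≤ (32 * |(n : ℝ)| / π) ^ 2 := by positivity
  calc ∑ m ∈ W, G m ^ 2 = ∑ m ∈ W.filter (fun m => m % 4 = 2), G m ^ 2 := h1
    _ ≤ ∑ m ∈ Pp ∪ Pm, G m ^ 2 := h2
    _ ≤ ∑ m ∈ Pp, G m ^ 2 + ∑ m ∈ Pm, G m ^ 2 := h3
    _ ≤ 2 * ((32 * |(n : ℝ)| / π) ^ 2 *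
          ∑ k ∈ Finset.range K, 1 / ((lam - (4 * (k : ℝ) + 2)) ^ 2 * (lam + (4 * (k : ℝ) + 2)) ^ 2)) := by linarith
    _ ≤ 2 * ((32 * |(n : ℝ)| / π) ^ 2 * (1 / 4 * ((1 / lam) ^ 2 * (1 / (lam - 4 * K₁) - 1 / lam) +
          (1 / (lam + 4 * K₁ + 2)) ^ 2 * (1 / (lam - 4 * K) - 1 / (lam - 4 * K₁))))) := by
        have := mul_le_mul_of_nonneg_left hsplit h0c
        linarith
    _ = _ := by ring

/-! ## §3 The rounded cascade chirp in a shifted window -/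

/-- **The rounded chirp in a shifted window**: `g₀(t) = e^{−2πif(t)}` continuous, `|nψ − f| ≤ η`; then for every `q` and finite `W`,
`√(Σ_{m∈W} ‖𝓕(twist ψ n)(m−q)‖²) ≤ √(Σ_{m∈W} ‖ĝ₀(m−q)‖²) + 2πη`. [cite: Grafakos2014, Prop. 3.2.7 (3)] -/
theorem sqrt_window_shift_twist_le (ψ : ShearProfile) (n q : ℤ) {f : ℝ → ℝ} {g₀ : UnitAddCircle → ℂ}
    (hg₀ : ∀ t : ℝ, g₀ (t : UnitAddCircle) = cexp (-(2 * π * I * ((f t : ℝ) : ℂ)))) (hg₀c : Continuous g₀) {η : ℝ}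
    (hη : ∀ t : ℝ, |n * ψ t - f t| ≤ η) (W : Finset ℤ) :
    Real.sqrt (∑ m ∈ W, ‖fourierCoeff (twist ψ n) (m - q)‖ ^ 2) ≤
      Real.sqrt (∑ m ∈ W, ‖fourierCoeff g₀ (m - q)‖ ^ 2) + 2 * π * η := by
  have h := sqrt_window_sq_twist_le ψ n hg₀ hg₀c hη (fun _ => (1 : ℂ)) {q} W
  simpa using h

end Summit.AnomalousDissipation.AnomalousDissipation.Theorems.SawtoothPulseCascade.K1Window
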